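import Mathlib
import Summits.NavierStokesRegularity.NavierStokesRegularity.Theorems.EulerZoomLiouvillePowerGaugeEulerLiouvilleClassicalConcentrating
import Literature.Analysis.FluidPDE.BackwardParticleMap
import Literature.Analysis.FluidPDE.TrajectoryGradientBound
import Literature.Analysis.FluidPDE.ClassicalSolutionGlue
import Literature.Analysis.FluidPDE.ElgindiBlowup
import HarnessLib.Audit

/-!
# Crux `EulerZoomLiouville.PowerGaugeEulerLiouville`: CLASSICAL MEMBERS WITH A SMALL TYPE-I GRADIENT ARE TRIVIAL
# (a stratum of `stub_nonSelfSimilarRest` with NO self-similarity, NO far-field and NO energy hypothesis)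

Route №10 `EulerZoomLiouville` (NavierStokesRegularity), crux E = stmt-NavierStokesRegularity-19832, registered residue
`stub_nonSelfSimilarRest` (energetic-past members that are neither (shifted-)self-similar nor classical-concentrating).
Lineage ns-typeII-p1 (gen 8).  MEMBER LEVEL.

The ANCIENT form of Chae's Type-I threshold (Chae, JFA 258 (2010) Thm 1.1: on `[0,T)`,
`(T−t)‖∇v(t)‖_∞ ≤ M₀ < 1` ⇒ no blow-up, via `‖ω(t)‖_∞ ≤ ‖ω(t₀)‖_∞((T−t₀)/(T−t))^{M₀}` and BKM).  For an ANCIENT classical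
Euler flow on `(−∞, 0) × ℝ³` with the Type-I gradient bound (d) `‖∇u(τ, x)‖ ≤ K/(−τ)` of the crux's concentrating stratum,
the same display read BACKWARD gives, along the particle trajectory through `(τ, x)` started at any earlier time `τ₀ < τ`,
`|ω(τ, x)| ≤ ((−τ₀)/(−τ))^K |ω(τ₀, X⁻¹)| ≤ ((−τ₀)/(−τ))^K · 4K/(−τ₀) = 4K (−τ₀)^{K−1} (−τ)^{−K}`
(Cauchy formula `ω(x,t) = ∇X · ω₀ ∘ X⁻¹` and `‖∇X‖ ≤ exp ∫‖∇u‖`, both in the tree), which tends to `0` as `τ₀ → −∞` when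
`K < 1`.  Hence **an ancient classical Euler flow with `sup_τ (−τ)‖∇u(τ)‖_∞ < 1` is IRROTATIONAL**, and an irrotational
member of the power-gauged class is trivial (the tail of the lead g5's `KelvinPhysical.ae_eq_zero_of_gauge_of_concentrating`:
the weak gradient is a.e. the classical one, hence symmetric, and `ae_eq_zero_of_gauge_of_irrotational`).

* `norm_curl_le_of_typeI_gradient` — `‖curl u(τ) x‖ ≤ 4K (−τ₀)^{K−1} (−τ)^{−K}` for `τ₀ < τ < 0` (any `K ≥ 0`);
* **`curl_eq_zero_of_smallTypeI`** — `K < 1` ⇒ `curl u(τ) ≡ 0` for every `τ < 0`;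
* **`ae_eq_zero_of_gauge_of_smallTypeI`** — MEMBER LEVEL: crux hypotheses verbatim (any `ρ > −1`) + `(u, p)` classical on
  the past + `‖∇u(τ, x)‖ ≤ K/(−τ)` with `K < 1` ⇒ `u = 0` a.e. on `(−∞,0) × ℝ³`.  No self-similarity, no velocity bound (a), no
  far field (b), no tail (c), no `L²`.  The first far-field-free classical stratum of `stub_nonSelfSimilarRest`; the constant
  `1` is the natural threshold (at a stagnation point of an exactly self-similar member the vorticity is an eigenvector of
  `(−τ)∇u` with eigenvalue `1`, CIV Thm 3.8; the tree's `exists_norm_fderiv_gt_of_selfSimilarEulerBlowup` is Chae's Cor 1.1).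

WHAT THIS IS NOT: not NS, not E — classical members whose Type-I gradient constant reaches `1` (all putative self-similar ones)
and the weak class are untouched. [cite: Chae2010, Thm 1.1 (proof display, read backward on the ancient time axis);
MajdaBertozziCUP2002 §1.6 (1.51), §2.5 (2.115)–(2.117), §4.2 (4.47)]
-/

noncomputable section

-- flat `Theorems/<Route><Decl>…` files of one crux share the namespace of the crux (tree convention)
set_option linter.dupNamespace false

open MeasureTheory Set Filter Topology Metric Function InnerProductSpace
open scoped RealInnerProductSpace NNReal ENNReal ContDiff

namespace Summit.NavierStokesRegularity.NavierStokesRegularity.Theorems.PowerGaugeEulerLiouville.KelvinPhysical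

open Literature.Analysis Literature.Analysis.FunctionSpaces Literature.Analysis.FluidPDE

variable {u : ℝ → EuclideanSpace ℝ (Fin 3) → EuclideanSpace ℝ (Fin 3)}
  {p : ℝ → EuclideanSpace ℝ (Fin 3) → ℝ}

/-! ### Vorticity along trajectories under the Type-I gradient bound, read backward -/

/-- **Backward Cauchy estimate**: for an ancient classical Euler flow with `‖∇u(σ, x)‖ ≤ K/(−σ)` (`K ≥ 0`) and `τ₀ < τ < 0`,
`‖ω(τ, x)‖ ≤ 4K (−τ₀)^{K−1} (−τ)^{−K}` for every `x` (time-translate to start at `τ₀`, Cauchy formula in Eulerian form,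
`‖∇X‖ ≤ exp ∫_{τ₀}^{τ} K/(−σ) dσ = ((−τ₀)/(−τ))^K`, and `|ω(τ₀)| ≤ 4‖∇u(τ₀)‖ ≤ 4K/(−τ₀)`).
[cite: Chae2010, Thm 1.1 (proof display); MajdaBertozziCUP2002 §2.5 (2.115)–(2.117), §4.2 (4.47)] -/
theorem norm_curl_le_of_typeI_gradient (hcl : IsClassicalEulerSolutionOn (Iio 0) 0 u p) {K : ℝ} (hK0 : 0 ≤ K)
    (hK : ∀ σ : ℝ, σ < 0 → ∀ x, ‖fderiv ℝ (u σ) x‖ ≤ K / (-σ)) {τ₀ τ : ℝ} (h0 : τ₀ < τ) (hτ : τ < 0)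
    (x : EuclideanSpace ℝ (Fin 3)) :
    ‖curl (u τ) x‖ ≤ 4 * K * (-τ₀) ^ (K - 1) * (-τ) ^ (-K) := by
  have hτ₀ : τ₀ < 0 := h0.trans hτ
  have hnτ₀ : 0 < -τ₀ := by linarith
  have hnτ : 0 < -τ := by linarith
  -- the time-translated flow `v t = u (t + τ₀)` on `(−∞, −τ₀) ∋ 0`
  set v : ℝ → EuclideanSpace ℝ (Fin 3) → EuclideanSpace ℝ (Fin 3) := fun t => u (t + τ₀) with hv
  set q : ℝ → EuclideanSpace ℝ (Fin 3) → ℝ := fun t => p (t + τ₀) with hq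
  set S : Set ℝ := Iio (-τ₀) with hSdef
  have hclv : IsClassicalEulerSolutionOn S 0 v q := by
    have h1 := hcl.comp_add_right τ₀
    refine h1.mono (fun t ht => ?_) (uniqueDiffOn_Iio (-τ₀))
    show t + τ₀ < 0
    rw [hSdef, mem_Iio] at ht
    linarith
  have hS : Convex ℝ S := convex_Iio _
  have hU : UniqueDiffOn ℝ S := uniqueDiffOn_Iio _
  have h0S : (0 : ℝ) ∈ S := by rw [hSdef, mem_Iio]; linarith
  -- Cauchy–Lipschitz on `S`: the gradient of `v t` is bounded by `K/(−(t₁+τ₀))` on compact `C ⊆ S` with top `t₁`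
  have hLv : ODE.IsUniformlyLipschitzOn v S := by
    refine hclv.smooth_velocity.isUniformlyLipschitzOn_of_norm_fderiv_le fun C hC hCS => ?_
    rcases C.eq_empty_or_nonempty with rfl | hne
    · exact ⟨0, fun t ht => absurd ht (notMem_empty t)⟩
    obtain ⟨t₁, ht₁C, ht₁⟩ := hC.exists_isMaxOn hne continuous_id.continuousOn
    have ht₁S : t₁ + τ₀ < 0 := by have := hCS ht₁C; rw [hSdef, mem_Iio] at this; linarith
    refine ⟨K / (-(t₁ + τ₀)), fun t ht y => ?_⟩
    have htS : t + τ₀ < 0 := by have := hCS ht; rw [hSdef, mem_Iio] at this; linarith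
    have hle : t ≤ t₁ := ht₁ ht
    calc ‖fderiv ℝ (v t) y‖ = ‖fderiv ℝ (u (t + τ₀)) y‖ := rfl
      _ ≤ K / (-(t + τ₀)) := hK _ htS y
      _ ≤ K / (-(t₁ + τ₀)) := div_le_div_of_nonneg_left hK0 (by linarith) (by linarith)
  -- the time `t = τ − τ₀ ∈ S`, `t > 0`
  set t : ℝ := τ - τ₀ with htdef
  have ht0 : 0 ≤ t := by rw [htdef]; linarith
  have htS : t ∈ S := by rw [hSdef, mem_Iio, htdef]; linarith
  -- Cauchy formula in Eulerian form at time `t` of `v`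
  set a : EuclideanSpace ℝ (Fin 3) := ODE.evolutionMap v t 0 x with ha
  have hcauchy := hclv.curl_eq_fderiv_evolutionMap_apply hS h0S hU hLv htS x
  have hvt : v t = u τ := by simp [hv, htdef]
  have hv0 : v 0 = u τ₀ := by simp [hv]
  -- the deformation bound `‖∇X_t‖ ≤ ((−τ₀)/(−τ))^K`
  set M : ℝ → ℝ := fun s => K / (-(s + τ₀)) with hMdef
  have hMc : ContinuousOn M (Icc 0 t) := by
    have hc : Continuous fun s : ℝ => -(s + τ₀) := by fun_prop
    refine ContinuousOn.div continuousOn_const hc.continuousOn fun s hs => ?_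
    have : s + τ₀ ≤ τ := by rw [htdef] at hs; linarith [hs.2]
    linarith
  have hM : ∀ s ∈ Icc 0 t, ∀ y, ‖fderiv ℝ (v s) y‖ ≤ M s := by
    intro s hs y
    have hsτ : s + τ₀ < 0 := by rw [htdef] at hs; linarith [hs.2]
    exact hK _ hsτ y
  have hDX := norm_fderiv_evolutionMap_zero_le_exp_integral hLv hclv.smooth_velocity hS hU h0S htS ht0 hMc hM a
  -- `∫₀ᵗ K/(−(s+τ₀)) ds = K log((−τ₀)/(−τ))`
  have hint : ∫ s in (0 : ℝ)..t, M s = K * Real.log ((-τ₀) / (-τ)) := by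
    have h1 : ∫ s in (0 : ℝ)..t, M s = ∫ s in (0 : ℝ)..t, K * (fun σ : ℝ => -(σ⁻¹)) (s + τ₀) := by
      refine intervalIntegral.integral_congr fun s _ => ?_
      simp only [hMdef]
      rw [div_eq_mul_inv, inv_neg]
    rw [h1, intervalIntegral.integral_const_mul,
      intervalIntegral.integral_comp_add_right (fun σ : ℝ => -(σ⁻¹)) τ₀, zero_add]
    rw [show t + τ₀ = τ by rw [htdef]; ring, intervalIntegral.integral_neg, integral_inv_of_neg hτ₀ hτ]
    rw [← Real.log_inv, inv_div]
    congr 1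
    rw [neg_div_neg_eq]
  have hexp : Real.exp (∫ s in (0 : ℝ)..t, M s) = ((-τ₀) / (-τ)) ^ K := by
    rw [hint, Real.rpow_def_of_pos (div_pos hnτ₀ hnτ), mul_comm]
  rw [hexp] at hDX
  -- the initial vorticity `|ω(τ₀, a)| ≤ 4K/(−τ₀)`
  have hω0 : ‖curl (v 0) a‖ ≤ 4 * (K / (-τ₀)) := by
    rw [hv0]
    exact (norm_curl_le_four_mul (u τ₀) a).trans (mul_le_mul_of_nonneg_left (hK τ₀ hτ₀ a) (by norm_num))
  -- assemble
  have hmain : ‖curl (u τ) x‖ ≤ ((-τ₀) / (-τ)) ^ K * (4 * (K / (-τ₀))) := by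
    rw [← hvt, hcauchy]
    refine (ContinuousLinearMap.le_opNorm _ _).trans ?_
    exact mul_le_mul hDX hω0 (norm_nonneg _) (Real.rpow_nonneg (div_pos hnτ₀ hnτ).le K)
  refine hmain.trans (le_of_eq ?_)
  rw [Real.div_rpow hnτ₀.le hnτ.le, Real.rpow_sub_one hnτ₀.ne', Real.rpow_neg hnτ.le]
  field_simp

/-- **An ancient classical Euler flow with a SMALL Type-I gradient is irrotational**: `‖∇u(σ, x)‖ ≤ K/(−σ)` for all `σ < 0`
with `K < 1` ⇒ `curl u(τ) ≡ 0` for every `τ < 0` (let `τ₀ → −∞` in `norm_curl_le_of_typeI_gradient`: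
`(−τ₀)^{K−1} → 0`). [cite: Chae2010, Thm 1.1 (ancient form)] -/
theorem curl_eq_zero_of_smallTypeI (hcl : IsClassicalEulerSolutionOn (Iio 0) 0 u p) {K : ℝ} (hK1 : K < 1)
    (hK : ∀ σ : ℝ, σ < 0 → ∀ x, ‖fderiv ℝ (u σ) x‖ ≤ K / (-σ)) {τ : ℝ} (hτ : τ < 0)
    (x : EuclideanSpace ℝ (Fin 3)) : curl (u τ) x = 0 := by
  have hK0 : 0 ≤ K := by
    have h := hK τ hτ x
    have hnτ : 0 < -τ := by linarith
    by_contra hneg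
    push Not at hneg
    have : K / (-τ) < 0 := div_neg_of_neg_of_pos hneg hnτ
    linarith [norm_nonneg (fderiv ℝ (u τ) x)]
  have hnτ : 0 < -τ := by linarith
  -- the bound tends to `0` as `τ₀ → −∞` (i.e. `−τ₀ → +∞`)
  have hlim : Tendsto (fun s : ℝ => 4 * K * s ^ (K - 1) * (-τ) ^ (-K)) atTop (𝓝 0) := by
    have h1 : Tendsto (fun s : ℝ => s ^ (-(1 - K))) atTop (𝓝 0) := tendsto_rpow_neg_atTop (by linarith)
    have h2 := (h1.const_mul (4 * K)).mul_const ((-τ) ^ (-K))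
    simp only [mul_zero, zero_mul] at h2
    refine h2.congr fun s => ?_
    rw [show -(1 - K) = K - 1 by ring]
  rw [← norm_le_zero_iff]
  refine ge_of_tendsto hlim ?_
  filter_upwards [eventually_gt_atTop (-τ)] with s hs
  have hs0 : 0 < s := hnτ.trans hs
  have h := norm_curl_le_of_typeI_gradient hcl hK0 hK (τ₀ := -s) (by linarith) hτ x
  rw [neg_neg] at h
  exact h

/-! ### Member level: small Type-I gradient ⇒ trivial -/

/-- **CLASSICAL MEMBERS WITH A SMALL TYPE-I GRADIENT ARE TRIVIAL.**  Crux hypotheses verbatim (any `ρ > −1`) + `(u, p)`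
classical on the past + `‖∇u(τ, x)‖ ≤ K/(−τ)` for all `τ < 0` with `K < 1` ⇒ `u = 0` a.e. on `(−∞, 0) × ℝ³`.  The flow is
irrotational (`curl_eq_zero_of_smallTypeI`), the weak gradient `H` is a.e. the (symmetric) classical one, and an
irrotational member of the power-gauged class vanishes (`ae_eq_zero_of_gauge_of_irrotational`).  No self-similarity, no
velocity bound, no far-field or tail hypothesis. [cite: Chae2010, Thm 1.1 (ancient form); folklore (irrotational tail)] -/
theorem ae_eq_zero_of_gauge_of_smallTypeI {ρ : ℝ} (hρ : -1 < ρ)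
    {H : ℝ → EuclideanSpace ℝ (Fin 3) → EuclideanSpace ℝ (Fin 3) →L[ℝ] EuclideanSpace ℝ (Fin 3)}
    {c : ℝ≥0}
    (hsw : IsSuitableWeakSolutionOn (slab (EuclideanSpace ℝ (Fin 3)) (Iio 0) isOpen_Iio) 0 0 u p)
    (hH : HasWeakSpatialGradientOn (slab (EuclideanSpace ℝ (Fin 3)) (Iio 0) isOpen_Iio) u H)
    (hgauge : ∀ a : ℝ, 0 < a →
      ENNReal.ofReal (a ^ (2 * ρ)) * cknA a (0 : ℝ × EuclideanSpace ℝ (Fin 3)) u +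
          ENNReal.ofReal (a ^ ρ) * cknE a (0 : ℝ × EuclideanSpace ℝ (Fin 3)) H +
        ENNReal.ofReal (a ^ (2 * ρ)) * cknD a (0 : ℝ × EuclideanSpace ℝ (Fin 3)) p ≤ (c : ℝ≥0∞))
    (hcl : IsClassicalEulerSolutionOn (Iio 0) 0 u p)
    {K : ℝ} (hK1 : K < 1) (hK : ∀ τ : ℝ, τ < 0 → ∀ x, ‖fderiv ℝ (u τ) x‖ ≤ K / (-τ)) :
    uncurry u =ᵐ[volume.restrict (Iio (0 : ℝ) ×ˢ (univ : Set (EuclideanSpace ℝ (Fin 3))))] 0 := by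
  have hcurl0 : ∀ τ : ℝ, τ < 0 → ∀ x, curl (u τ) x = 0 := fun τ hτ x => curl_eq_zero_of_smallTypeI hcl hK1 hK hτ x
  -- irrotational classical members are trivial (the tail of `ae_eq_zero_of_gauge_of_concentrating`)
  have h1 := ae_hasWeakGradient_slice_of_slab hH
  have h2 : ∀ᵐ t ∂(volume.restrict (Iio (0 : ℝ))),
      (fun x => H t x) =ᵐ[volume] fun x => fderiv ℝ (u t) x := by
    filter_upwards [h1, ae_restrict_mem measurableSet_Iio] with t ht htneg
    have hcl1 : ContDiff ℝ 1 (u t) := (hcl.contDiff_velocity htneg).of_le (by exact_mod_cast le_top)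
    have hw : HasWeakGradient (u t) (fderiv ℝ (u t)) := hasWeakGradient_fderiv_of_contDiff hcl1
    have := HasWeakFDerivOn.unique_holds ht hw
    rwa [TopologicalSpace.Opens.coe_top, Measure.restrict_univ] at this
  have hμ : (volume : Measure (ℝ × EuclideanSpace ℝ (Fin 3))).restrict
      (Iio (0 : ℝ) ×ˢ (univ : Set (EuclideanSpace ℝ (Fin 3)))) =
      (volume.restrict (Iio (0 : ℝ))).prod (volume : Measure (EuclideanSpace ℝ (Fin 3))) := by
    rw [Measure.volume_eq_prod, Measure.restrict_prod_eq_prod_univ]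
  have hHm : AEStronglyMeasurable (uncurry H)
      ((volume.restrict (Iio (0 : ℝ))).prod (volume : Measure (EuclideanSpace ℝ (Fin 3)))) := by
    have := hH.locallyIntegrableOn_grad.aestronglyMeasurable
    rw [← hμ]; simpa [slab] using this
  have hGcont : ContinuousOn (uncurry fun t x => fderiv ℝ (u t) x)
      (Iio (0 : ℝ) ×ˢ (univ : Set (EuclideanSpace ℝ (Fin 3)))) :=
    (hcl.smooth_velocity.fderiv_slice isOpen_Iio.uniqueDiffOn).continuousOn
  have hGm : AEStronglyMeasurable (uncurry fun t x => fderiv ℝ (u t) x)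
      ((volume.restrict (Iio (0 : ℝ))).prod (volume : Measure (EuclideanSpace ℝ (Fin 3)))) := by
    rw [← hμ]
    exact hGcont.aestronglyMeasurable (measurableSet_Iio.prod MeasurableSet.univ)
  have hHG : uncurry H =ᵐ[(volume.restrict (Iio (0 : ℝ))).prod volume]
      uncurry fun t x => fderiv ℝ (u t) x :=
    ae_eq_prod_of_ae_ae_eq hHm hGm h2
  have hsym : ∀ᵐ z ∂(volume.restrict (Iio (0 : ℝ) ×ˢ (univ : Set (EuclideanSpace ℝ (Fin 3))))),
      ∀ v w : EuclideanSpace ℝ (Fin 3), ⟪H z.1 z.2 v, w⟫ = ⟪H z.1 z.2 w, v⟫ := by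
    rw [hμ]
    have hmem : ∀ᵐ z ∂((volume.restrict (Iio (0 : ℝ))).prod
        (volume : Measure (EuclideanSpace ℝ (Fin 3)))), z.1 < 0 := by
      rw [← hμ]
      filter_upwards [ae_restrict_mem (measurableSet_Iio.prod MeasurableSet.univ)] with z hz
      exact hz.1
    filter_upwards [hHG, hmem] with z hz hzneg v w
    have e : H z.1 z.2 = fderiv ℝ (u z.1) z.2 := hz
    rw [e]
    exact inner_fderiv_comm_of_curl_eq_zero
      (((hcl.contDiff_velocity hzneg).differentiable (by simp)) z.2) (hcurl0 z.1 hzneg z.2) v w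
  exact ae_eq_zero_of_gauge_of_irrotational hρ hsw hH hgauge hsym

end Summit.NavierStokesRegularity.NavierStokesRegularity.Theorems.PowerGaugeEulerLiouville.KelvinPhysical

end
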